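import Mathlib.AlgebraicGeometry.Geometrically.Integral
import Mathlib.AlgebraicGeometry.Morphisms.Flat
import Mathlib.Topology.Sets.OpenCover
import Literature.FieldTheory.Regular.AlgClosedTensorDomain
import HarnessLib

/-!
# Integral schemes over an algebraically closed field are geometrically integral
# (Görtz–Wedhorn I, Prop. 5.51 and Cor. 5.54)

For an algebraically closed field `k`, every integral `k`-scheme `X` is geometrically integral
(`geometricallyIntegral_of_isAlgClosed`): for any field `L ⊇ k` the base change
`X_L = X ×ₖ Spec L` is integral. This is Görtz–Wedhorn I, Prop. 5.51 (iv) ⇒ (i) with `Ω = k`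
(equivalently Cor. 5.54 with `K = k`). The proof here is the affine one: `π : X_L → X` is affine
and surjective, and for a nonempty affine open `U ⊆ X` the coordinate ring of `π⁻¹U` is
`Γ(X, U) ⊗ₖ L` (Mathlib `isIso_pushoutSection_of_isAffineOpen`), a domain because tensor products
of domains over an algebraically closed field are domains
(`Literature.FieldTheory.Regular.isDomain_tensorProduct_of_isAlgClosed`, Lang, *Algebra* VIII §4);
these integral opens cover `X_L` and meet pairwise, so `X_L` is reduced and irreducible
(Mathlib `IsPreirreducible.of_subset_iUnion`). No finiteness hypothesis on `X` is needed.

Used for abelian subvarieties of abelian varieties over `k = k̄` (the identity component of the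
kernel of a homomorphism, `Motives/AbelianVarietyImage` and its sequel), whose structure requires
`GeometricallyIntegral`.

Mathlib searched (pin): `GeometricallyIntegral`, `geometrically_iff_of_commRing`,
`isIso_pushoutSection_of_isAffineOpen`, `isIso_pushoutSection_iff`,
`CommRingCat.isPushout_iff_isPushout`, `Algebra.IsPushout.equiv`, `flat_and_surjective_SpecMap_iff`,
`IsPreirreducible.of_subset_iUnion`, `Scheme.openCoverOfIsOpenCover`, `IsReduced.of_openCover`,
`isIntegral_of_isAffine_of_isDomain` (all used); Mathlib has geometric integrality only as a
definition with permanence properties, no criterion over algebraically/separably closed fields.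

## References

* U. Görtz, T. Wedhorn, *Algebraic Geometry I: Schemes*, 2nd ed., Springer Spektrum (2020),
  doi:10.1007/978-3-658-30733-2: Prop. 5.51 and Cor. 5.54 (read via the held copy, PDF pp. 170–171).
  [GortzWedhorn2020]
* S. Lang, *Algebra*, 3rd ed., GTM 211, Springer (2002), VIII §4, Cor. 4.14. [Lang2002]
-/

universe u

open CategoryTheory CategoryTheory.Limits AlgebraicGeometry TopologicalSpace
open scoped TensorProduct

namespace Literature.AlgebraicGeometry.Motives

variable {k : Type u} [Field k] {L : Type u} [Field L] [Algebra k L]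
  {X X' : Scheme.{u}} {p : X ⟶ Spec (.of k)} {p' : X' ⟶ Spec (.of L)} {π : X' ⟶ X}

/-- **Affine base change of sections over an algebraically closed field.** For a cartesian square
`π : X' = X ×ₖ Spec L → X` over a field extension `L ⊇ k` with `k` algebraically closed and an
affine open `U ⊆ X` with `Γ(X, U)` a domain, `Γ(X', π⁻¹U) ≅ Γ(X, U) ⊗ₖ L` (Mathlib
`isIso_pushoutSection_of_isAffineOpen`) is a domain (tensor products of domains over an
algebraically closed field, `Literature.FieldTheory.Regular.isDomain_tensorProduct_of_isAlgClosed`).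
[cite: Lang2002, VIII §4] -/
theorem isDomain_sections_preimage_of_isPullback [IsAlgClosed k]
    (H : IsPullback π p' p (Spec.map (CommRingCat.ofHom (algebraMap k L)))) {U : X.Opens}
    (hU : IsAffineOpen U) [IsDomain Γ(X, U)] : IsDomain Γ(X', π ⁻¹ᵁ U) := by
  classical
  let φ : Γ(X, U) ⟶ Γ(X', π ⁻¹ᵁ U) := π.appLE U (π ⁻¹ᵁ U) le_rfl
  let ιk : CommRingCat.of k ⟶ Γ(Spec (CommRingCat.of k), ⊤) :=
    (Scheme.ΓSpecIso (CommRingCat.of k)).inv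
  let ιL : CommRingCat.of L ⟶ Γ(Spec (CommRingCat.of L), ⊤) :=
    (Scheme.ΓSpecIso (CommRingCat.of L)).inv
  let fk : CommRingCat.of k ⟶ Γ(X, U) := ιk ≫ p.appLE ⊤ U le_top
  let gL : CommRingCat.of L ⟶ Γ(X', π ⁻¹ᵁ U) := ιL ≫ p'.appLE ⊤ (π ⁻¹ᵁ U) le_top
  letI : Algebra Γ(X, U) Γ(X', π ⁻¹ᵁ U) := φ.hom.toAlgebra
  letI : Algebra k Γ(X, U) := fk.hom.toAlgebra
  letI : Algebra L Γ(X', π ⁻¹ᵁ U) := gL.hom.toAlgebra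
  letI : Algebra k Γ(X', π ⁻¹ᵁ U) := (φ.hom.comp fk.hom).toAlgebra
  haveI : IsScalarTower k Γ(X, U) Γ(X', π ⁻¹ᵁ U) := IsScalarTower.of_algebraMap_eq fun _ ↦ rfl
  -- `appLE ⊤ ⊤` is `appTop`, and `appLE` only depends on the morphism
  have happTop : ∀ {Y Z : Scheme.{u}} (g : Y ⟶ Z), g.appLE ⊤ ⊤ le_top = g.appTop := by
    intro Y Z g
    rw [Scheme.Hom.appTop, Scheme.Hom.app_eq_appLE]
    rfl
  have happ : ∀ {g₁ g₂ : X' ⟶ Spec (CommRingCat.of k)} (_ : g₁ = g₂)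
      (h₁ : π ⁻¹ᵁ U ≤ g₁ ⁻¹ᵁ ⊤) (h₂ : π ⁻¹ᵁ U ≤ g₂ ⁻¹ᵁ ⊤),
      g₁.appLE ⊤ (π ⁻¹ᵁ U) h₁ = g₂.appLE ⊤ (π ⁻¹ᵁ U) h₂ := by
    rintro g₁ _ rfl _ _
    rfl
  -- the square `k → Γ(X, U)`, `k → L`, `Γ(X, U) → Γ(X', U')`, `L → Γ(X', U')` commutes ...
  have hsq : fk ≫ φ = CommRingCat.ofHom (algebraMap k L) ≫ gL := by
    have h1 : fk ≫ φ = ιk ≫ (π ≫ p).appLE ⊤ (π ⁻¹ᵁ U) le_top := by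
      simp only [fk, φ, Category.assoc, Scheme.Hom.appLE_comp_appLE]
    have h2 : CommRingCat.ofHom (algebraMap k L) ≫ gL =
        ιk ≫ (p' ≫ Spec.map (CommRingCat.ofHom (algebraMap k L))).appLE ⊤ (π ⁻¹ᵁ U) le_top := by
      simp only [gL, ιL, ιk, ← Category.assoc]
      rw [Scheme.ΓSpecIso_inv_naturality, Category.assoc, ← happTop, Scheme.Hom.appLE_comp_appLE]
    rw [h1, h2, happ H.w]
  have hsq' : φ.hom.comp fk.hom = gL.hom.comp (algebraMap k L) := by
    have := congrArg CommRingCat.Hom.hom hsq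
    simpa only [CommRingCat.hom_comp, CommRingCat.hom_ofHom] using this
  haveI : IsScalarTower k L Γ(X', π ⁻¹ᵁ U) :=
    IsScalarTower.of_algebraMap_eq fun a ↦ congr($hsq' a)
  -- ... and is a pushout (Mathlib: sections of a fibre product over affine opens)
  haveI : Algebra.IsPushout k Γ(X, U) L Γ(X', π ⁻¹ᵁ U) := by
    have hUY : π ⁻¹ᵁ U = π ⁻¹ᵁ U ⊓ p' ⁻¹ᵁ ⊤ := by simp
    have hiso := isIso_pushoutSection_of_isAffineOpen H (US := ⊤) (UT := ⊤) (UX := U)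
      le_top le_top hUY (isAffineOpen_top _) (isAffineOpen_top _) hU
    have hpo := (isIso_pushoutSection_iff H (US := ⊤) (UT := ⊤) (UX := U) le_top le_top hUY).mp
      hiso
    have hpo' : IsPushout fk (CommRingCat.ofHom (algebraMap k L)) φ gL := by
      refine hpo.of_iso (Scheme.ΓSpecIso (CommRingCat.of k)) (Iso.refl _)
        (Scheme.ΓSpecIso (CommRingCat.of L)) (Iso.refl _) ?_ ?_ ?_ ?_
      · simp [fk, ιk]
      · rw [happTop]
        exact Scheme.ΓSpecIso_naturality _
      · simp [φ]
      · simp [gL, ιL]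
    exact (CommRingCat.isPushout_iff_isPushout (R := k) (S := L) (R' := Γ(X, U))
      (S' := Γ(X', π ⁻¹ᵁ U))).mp hpo'
  -- hence `Γ(X', π⁻¹U) ≅ Γ(X, U) ⊗ₖ L`, a domain
  haveI : IsDomain (Γ(X, U) ⊗[k] L) :=
    Literature.FieldTheory.Regular.isDomain_tensorProduct_of_isAlgClosed k L Γ(X, U)
  exact MulEquiv.isDomain (Γ(X, U) ⊗[k] L)
    (Algebra.IsPushout.equiv k Γ(X, U) L Γ(X', π ⁻¹ᵁ U)).symm.toMulEquiv

/-- **An integral scheme over an algebraically closed field is geometrically integral**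
(Görtz–Wedhorn I, Cor. 5.56 (2) / Prop. 5.51; Stacks 020J, 0366): for `k` algebraically closed,
`X` integral and any field `L ⊇ k`, `X_L = X ×ₖ Spec L` is integral. `π : X_L → X` is affine and
surjective; for nonempty affine opens `U ⊆ X` the opens `π⁻¹U` are affine with coordinate ring
`Γ(X, U) ⊗ₖ L`, a domain (`isDomain_sections_preimage_of_isPullback`), they cover `X_L` and meet
pairwise (`U ∩ U' ≠ ∅` and `π` is onto), so `X_L` is reduced and irreducible.
[cite: GortzWedhorn2020, Prop. 5.51 and Cor. 5.54] -/
theorem geometricallyIntegral_of_isAlgClosed [IsAlgClosed k] (p : X ⟶ Spec (.of k))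
    [IsIntegral X] : GeometricallyIntegral p := by
  rw [GeometricallyIntegral.eq_geometrically]
  refine geometrically_iff_of_commRing.2 fun L _ _ W fst snd h => ?_
  -- `fst : W → X` is affine and surjective
  haveI : IsAffineHom fst :=
    MorphismProperty.of_isPullback (P := @IsAffineHom) h.flip inferInstance
  have hff : (CommRingCat.ofHom (algebraMap k L)).hom.FaithfullyFlat := by
    rw [CommRingCat.hom_ofHom, RingHom.faithfullyFlat_algebraMap_iff]
    infer_instance
  obtain ⟨-, hsurj⟩ := (flat_and_surjective_SpecMap_iff _).2 hff
  haveI : Surjective fst := MorphismProperty.of_isPullback (P := @Surjective) h.flip hsurj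
  -- the opens `fst⁻¹ U`, `U ⊆ X` nonempty affine
  let ι : Type u := {U : X.affineOpens // ((U : X.Opens) : Set X).Nonempty}
  let V : ι → W.Opens := fun i => fst ⁻¹ᵁ (i.1 : X.Opens)
  have hmemV : ∀ (i : ι) (w : W), w ∈ V i ↔ fst w ∈ (i.1 : X.Opens) := fun i w => Iff.rfl
  have hV : IsOpenCover V := by
    refine IsOpenCover.mk (eq_top_iff.2 fun w _ => ?_)
    obtain ⟨_, ⟨U, hU, rfl⟩, hxU, -⟩ :=
      X.isBasis_affineOpens.exists_subset_of_mem_open (Set.mem_univ (fst w)) isOpen_univ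
    exact Opens.mem_iSup.2 ⟨⟨⟨U, hU⟩, ⟨fst w, hxU⟩⟩, (hmemV _ w).2 hxU⟩
  have hpair : Pairwise (Function.onFun (¬ Disjoint · ·) V) := by
    intro i j _
    obtain ⟨x, hxi, hxj⟩ := nonempty_preirreducible_inter (i.1 : X.Opens).isOpen
      (j.1 : X.Opens).isOpen i.2 j.2
    obtain ⟨w, rfl⟩ := fst.surjective x
    change ¬ Disjoint (V i) (V j)
    rw [← Opens.coe_disjoint, Set.not_disjoint_iff]
    exact ⟨w, (hmemV i w).2 hxi, (hmemV j w).2 hxj⟩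
  -- each `fst⁻¹ U` is an integral affine scheme
  have hint : ∀ i, IsIntegral (V i : Scheme.{u}) := fun i => by
    have hU : IsAffineOpen (i.1 : X.Opens) := i.1.2
    have hU' : IsAffineOpen (V i) := hU.preimage fst
    haveI : IsAffine (V i : Scheme.{u}) := hU'
    obtain ⟨x, hx⟩ := i.2
    obtain ⟨w, rfl⟩ := fst.surjective x
    haveI : Nonempty (V i : Scheme.{u}) := ⟨⟨w, (hmemV i w).2 hx⟩⟩
    haveI : Nonempty (i.1 : X.Opens) := ⟨⟨fst w, hx⟩⟩
    haveI : IsDomain Γ(W, V i) := isDomain_sections_preimage_of_isPullback h hU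
    haveI : IsDomain Γ(V i, ⊤) :=
      MulEquiv.isDomain Γ(W, V i) (V i).topIso.commRingCatIsoToRingEquiv.toMulEquiv
    exact isIntegral_of_isAffine_of_isDomain _
  -- so `W` is irreducible ...
  have hirr : ∀ i, IsPreirreducible ((V i : W.Opens) : Set W) := fun i => by
    haveI := hint i
    have h1 : IsIrreducible (Set.range (V i).ι) := by
      rw [← Set.image_univ]
      exact (IrreducibleSpace.isIrreducible_univ _).image _ (V i).ι.continuous.continuousOn
    rw [Scheme.Opens.range_ι] at h1
    exact h1.2
  haveI : PreirreducibleSpace W :=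
    ⟨IsPreirreducible.of_subset_iUnion hpair hirr isOpen_univ (by simp [hV.iSup_set_eq_univ])⟩
  haveI : Nonempty W := by
    obtain ⟨x⟩ := (inferInstance : Nonempty X)
    obtain ⟨w, -⟩ := fst.surjective x
    exact ⟨w⟩
  haveI : IrreducibleSpace W := { toNonempty := inferInstance }
  -- ... and reduced
  haveI : ∀ i, IsReduced ((W.openCoverOfIsOpenCover V hV).X i) := fun i => by
    haveI := hint i
    change IsReduced (V i : Scheme.{u})
    infer_instance
  haveI : IsReduced W := IsReduced.of_openCover W (W.openCoverOfIsOpenCover V hV)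
  exact isIntegral_of_irreducibleSpace_of_isReduced W

end Literature.AlgebraicGeometry.Motives
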